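import Mathlib
import HarnessLib
import Summits.HubbardSuperconductivity.HubbardSuperconductivity.Theorems.KLProgrammeH10TwoPointLimitSectorMultiplierSupport
import Summits.HubbardSuperconductivity.HubbardSuperconductivity.Theorems.KLProgrammeKLRegimeFatAngularFactor
import Summits.HubbardSuperconductivity.HubbardSuperconductivity.Theorems.KLProgrammeKLRegimeSymbolProductSampledFirst
import Summits.HubbardSuperconductivity.HubbardSuperconductivity.Theorems.KLProgrammeKLRegimeSymbolProductSampledFirstZone
import Summits.HubbardSuperconductivity.HubbardSuperconductivity.Theorems.KLProgrammeKLRegimeCountertermFrameCurveLipschitz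

/-!
# Route `KLProgramme` — engine support, route (L2): the PACK for a FAT (mixed) multiplier pair on an admissible frame — sup, zone, cell,
# first AND second differences in time and along any integer step, support count — radial scales `(m₁, m₂)` decoupled from the angular
# scale `n` and angular factors summed over index sets `S₁, S₂`

Cell `gate-hubbard-kl`, seat hubbard-kl-k3c2-p3; gen-4 ENGINE child stmt-HubbardSuperconductivity-19855 (`stub_engine_step_norms`, propagator
`α_n`).  The p4 lineage's PACK (`…SectorMultiplierDiffs`/`…Support`) is for the thin pair `klAniso n₁ ω₁ × klAniso n₂ ω₂` (radial scale =
angular scale).  The single-scale step theorem pulls the slice covariance back by the FAT family (`bgmFatMultiplier`: radial plateau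
`C_{−(n−1)}⁻¹ = G_{n−1}`, angular plateau `Σ_{a∈S_ω} ζ̃_{n,a}`), whose pair symbol is `G_{m₁}G_{m₂}(k₀² + e_K²)·Z_fat` with `(m₁,m₂) = (n−1,n−1)`
and `Z_fat` the fat angular factor of `…FatAngularFactor`.  This file proves, for ANY sampled symbol of this mixed shape (hypothesis `hGsΦ`:
`Gs q = Φ(sample q)`; the identification for `bgmFatMultiplier` is a separate file):

* `fatPair_norm_le_one_mul_one`; `fatPair_profile_mul_angular_eq_zero` (zone); `fatPair_cell` (radius `ρ₀ + δ_F`: the cell of a neighbouring sector `a ∈ S₁` plus the displacement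
  `‖p_F(θ_{n,a}) − p_F(θ_c)‖ ≤ δ_F` of its Fermi point from the chosen centre `θ_c`);
* **`norm_fwdDiff_two_time_fatPair_le`**, **`norm_fwdDiff_time_fatPair_le`** (window `Λ_{m₁}β < π(2M−3)`);
* **`norm_fwdDiff_two_space_fatPair_le`**, **`norm_fwdDiff_space_fatPair_le`** (integer step `u`, `4π|u_j| ≤ zL`, tangency datum at `p_F(θ_c)`);
* **`card_support_fatPair_le`**.

Everything is proved; no definitions, no named facts. [folklore]

References: G. Benfatto, A. Giuliani, V. Mastropietro, Ann. Henri Poincaré 7 (2006) 809–898, §2.5 Lemma 2.2, §2.7 (2.66)–(2.71a), §2.8 (2.81).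
-/

noncomputable section

namespace Summit.HubbardSuperconductivity.HubbardSuperconductivity.Theorems.TorusFourierL2

set_option linter.dupNamespace false -- summit = problem name (single-conjunct summit), D-0017

open Set Finset Literature.MathematicalPhysics.QuantumLattice Literature.MathematicalPhysics.QuantumLattice.BandSectorCounting
open Literature.MathematicalPhysics.QuantumLattice.FermiRG Literature.Probability.LatticeModels Literature.Analysis.SpecialFunctions
open Summit.HubbardSuperconductivity.HubbardSuperconductivity.Theorems.DispersionFlow
open Summit.HubbardSuperconductivity.HubbardSuperconductivity.Theorems.KLRegimeSplit
open Summit.HubbardSuperconductivity.HubbardSuperconductivity.Theorems.KLProgrammeLegKernels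
open Summit.HubbardSuperconductivity.HubbardSuperconductivity.Theorems.PerturbedFermiCurve
open scoped Real Nat

section FatPair

variable {L M : ℕ} [NeZero L] [NeZero M] {a b : ℝ} (B : BandBounds a b) {K : TrigPolyC4v} {A : ℝ}
  (hA : ∀ p : Momentum, ∀ j ≤ 2, ‖iteratedFDeriv ℝ j (frameShift K) p‖ ≤ A) (hADt : 2 * A < B.Dtmin)
  {μ e₀ z β : ℝ} (he : 0 < e₀) (hz : 0 < z) (hz1 : z ≤ 1) (hgap : e₀ + A + z ^ 2 < -μ) (h3 : e₀ + A - μ ≤ 3)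
  (hlo : a ≤ μ - A - e₀) (hhi : μ + A + e₀ ≤ b) (hβ : 0 < β) (hρA : 4 * A < 2 * B.rhomin)
  {m₁ m₂ : ℕ} (hm : m₂ ≤ m₁) {n : ℕ} {S₁ S₂ : Finset ℕ} (hS₁ : S₁ ⊆ range (sectorCount n)) (hS₂ : S₂ ⊆ range (sectorCount n))
  {θc δF : ℝ} (hδF : 0 ≤ δF) (hδ : ∀ a' ∈ S₁, ‖klFermiPoint μ K (sectorCenter n a') - klFermiPoint μ K θc‖ ≤ δF)
  {d : ℝ} (hd : 0 ≤ d) (hd1 : ∀ u, |deriv (bgmCutoffSq e₀) u| ≤ d) (hd2 : ∀ u, |iteratedDeriv 2 (bgmCutoffSq e₀) u| ≤ d)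
  {Z : (Fin 2 → ℝ) → ℝ}
  (hZ : ∀ p, Z p = gnCutoff ((π + z) ^ 2 / π ^ 2) ((π + z) ^ 2) (p 0 ^ 2) * gnCutoff ((π + z) ^ 2 / π ^ 2) ((π + z) ^ 2) (p 1 ^ 2) *
    ((radialCutoffC (1 / 2) (momToComplex p) * ∑ a' ∈ S₁, sectorWeightCirc n ((a' : ℕ) : ℤ) (polarAngle p)) *
      (radialCutoffC (1 / 2) (momToComplex p) * ∑ b' ∈ S₂, sectorWeightCirc n ((b' : ℕ) : ℤ) (polarAngle p))))
  {Φ : ℝ × (Fin 2 → ℝ) → ℂ}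
  (hΦ : ∀ k₀ p, Φ (k₀, p) = ((bgmCutoffSq e₀ ((16 : ℝ) ^ m₁ * (k₀ ^ 2 + frameLevel μ K (WithLp.toLp 2 p) ^ 2)) *
      bgmCutoffSq e₀ ((16 : ℝ) ^ m₂ * (k₀ ^ 2 + frameLevel μ K (WithLp.toLp 2 p) ^ 2)) * Z p : ℝ) : ℂ))
  {Gs : TorusSite 1 (2 * M) × TorusSite 2 L → ℂ}
  (hGsΦ : ∀ q, Gs q = Φ (π * (1 - 2 * M) / β + 2 * π / β * (((q.1 0).val : ℕ) : ℝ), fun j => 2 * π / L * (((q.2 j).valMinAbs : ℤ) : ℝ)))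

include hZ hΦ hGsΦ hS₁ hS₂ in
omit [NeZero L] [NeZero M] in
/-- **`‖G̃‖ ≤ 1·1`** (profile `≤ 1` times angular factor `≤ 1`; stated as the product to keep the two sources visible). [folklore] -/
theorem fatPair_norm_le_one_mul_one (q : TorusSite 1 (2 * M) × TorusSite 2 L) : ‖Gs q‖ ≤ 1 * 1 := by
  rw [mul_one, hGsΦ q, hΦ, Complex.norm_real, Real.norm_eq_abs, abs_mul, abs_mul]
  have h1 := abs_bgmCutoffSq_le_one e₀ ((16 : ℝ) ^ m₁ * ((π * (1 - 2 * M) / β + 2 * π / β * (((q.1 0).val : ℕ) : ℝ)) ^ 2 +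
    frameLevel μ K (WithLp.toLp 2 fun j => 2 * π / L * (((q.2 j).valMinAbs : ℤ) : ℝ)) ^ 2))
  have h2 := abs_bgmCutoffSq_le_one e₀ ((16 : ℝ) ^ m₂ * ((π * (1 - 2 * M) / β + 2 * π / β * (((q.1 0).val : ℕ) : ℝ)) ^ 2 +
    frameLevel μ K (WithLp.toLp 2 fun j => 2 * π / L * (((q.2 j).valMinAbs : ℤ) : ℝ)) ^ 2))
  have h3' := abs_fatAngular_le_one hZ hS₁ hS₂ (fun j => 2 * π / L * (((q.2 j).valMinAbs : ℤ) : ℝ))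
  calc _ ≤ 1 * 1 * 1 := mul_le_mul (mul_le_mul h1 h2 (abs_nonneg _) zero_le_one) h3' (abs_nonneg _) (by norm_num)
    _ = 1 := by norm_num

include hA hz hz1 hgap he hZ in
omit [NeZero L] [NeZero M] in
/-- **Zone, real form**: the product `G_{m₁}(16^{m₁}(k₀² + e_K(p)²))·Z(p)` vanishes as soon as some `|p_j| ≥ π − z` (far: the square cutoff;
strip: the band exceeds `e₀ ≥ Λ_{m₁}`). [folklore] -/
theorem fatPair_profile_mul_angular_eq_zero (k₀ : ℝ) (p : Fin 2 → ℝ) (hp : ∃ j, π - z ≤ |p j|) :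
    bgmCutoffSq e₀ ((16 : ℝ) ^ m₁ * (k₀ ^ 2 + frameLevel μ K (WithLp.toLp 2 p) ^ 2)) * Z p = 0 := by
  obtain ⟨j, hj⟩ := hp
  rcases le_or_gt (π + z) |p j| with hfar | hnear
  · have hZ0 : Z p = 0 := by
      by_contra hne
      exact absurd (abs_lt_of_fatAngular_ne_zero hZ hz hne j) (not_lt.2 hfar)
    rw [hZ0, mul_zero]
  · have hband : e₀ < |frameLevel μ K (WithLp.toLp 2 p)| := frameBand_zone hA hz1 hgap hj hnear.le
    have hu : klScale e₀ m₁ ^ 2 < k₀ ^ 2 + frameLevel μ K (WithLp.toLp 2 p) ^ 2 := by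
      have h1 := klScale_le_e0 he.le m₁
      have h2 : 0 < klScale e₀ m₁ := by rw [klScale]; positivity
      have h3' : e₀ ^ 2 < frameLevel μ K (WithLp.toLp 2 p) ^ 2 := by
        have := sq_lt_sq' (by linarith [abs_nonneg (frameLevel μ K (WithLp.toLp 2 p))]) hband
        rwa [sq_abs] at this
      nlinarith [pow_le_pow_left₀ h2.le h1 2, sq_nonneg k₀]
    obtain ⟨d', -, hd1', hd2'⟩ := exists_abs_derivs_bgmCutoffSq_le he
    rw [(scaleProfile_bounds he m₁ hd1' hd2').2.2.2.2 _ hu, zero_mul]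

include B hA hADt hz hz1 hgap he hlo hhi hZ hδ in
/-- **Cell**: a point of the square-with-margin in the shell `|e_K| ≤ Λ_{m₁}` with `Z ≠ 0` lies within `ρ₀ + δ_F` of `p_F(θ_c)` (sup norm),
`ρ₀ = (Λ_{m₁} + s_max Dt_min (3w_n/4))/(Dt_min − 2A)`. [cite: BenfattoGiulianiMastropietro2006, §2.7 (2.69)] -/
theorem fatPair_cell (p : Fin 2 → ℝ) (hsq : ∀ i, |p i| ≤ π + z) (hshell : |frameLevel μ K (WithLp.toLp 2 p)| ≤ klScale e₀ m₁)
    (hZp : Z p ≠ 0) :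
    ‖p - klFermiPoint μ K θc‖ ≤ (klScale e₀ m₁ + B.smax * B.Dtmin * (3 * sectorWidth n / 4)) / (B.Dtmin - 2 * A) + δF := by
  have hΛ := klScale_le_e0 he.le m₁
  obtain ⟨⟨a', ha', hζ⟩, -⟩ := fatAngular_support hZ hZp
  have h1 := frameBand_cell B hA hADt hz.le hz1 (by linarith) (by linarith) (by linarith) n a' hsq hshell hζ
  have h2 := hδ a' ha'
  calc ‖p - klFermiPoint μ K θc‖ = ‖(p - klFermiPoint μ K (sectorCenter n a')) + (klFermiPoint μ K (sectorCenter n a') - klFermiPoint μ K θc)‖ := by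
        congr 1; abel
    _ ≤ _ := (norm_add_le _ _).trans (add_le_add h1 h2)

include he hβ hm hd hd1 hd2 hZ hΦ hGsΦ hS₁ hS₂ in
omit [NeZero L] in
/-- **Time, second difference**: `‖Δ²_{(1,0)} G̃(q)‖ ≤ (4g₂+2g₁)(2π/β)²/Λ_{m₁}²` for every `q`, provided `Λ_{m₁}β < π(2M − 3)`.
[cite: BenfattoGiulianiMastropietro2006, §2.5 Lemma 2.2 (2.52), (2.56)] -/
theorem norm_fwdDiff_two_time_fatPair_le (hM : klScale e₀ m₁ * β < π * (2 * M - 3)) (q : TorusSite 1 (2 * M) × TorusSite 2 L) :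
    ‖((fwdDiff ((fun _ : Fin 1 => (1 : ZMod (2 * M))), (0 : TorusSite 2 L)))^[2] Gs) q‖ ≤
      (4 * ((d * e₀ ^ 4 * 1 + 2 * (d * e₀ ^ 2) * (d * e₀ ^ 2) + 1 * (d * e₀ ^ 4))) + 2 * (d * e₀ ^ 2 * 1 + 1 * (d * e₀ ^ 2))) *
        (2 * π / β) ^ 2 * 1 / klScale e₀ m₁ ^ 2 := by
  obtain ⟨hGc, -, hG1, hG2, hGv⟩ := scaleProfile_mul_bounds he hm hd hd1 hd2
  have hΛ : 0 < klScale e₀ m₁ := by rw [klScale]; positivity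
  exact norm_fwdDiff_two_time_sampledSymbol_le hGc hΛ (by positivity) (by positivity) hG1 hG2 hGv
    (fun p : Fin 2 → ℝ => frameLevel μ K (WithLp.toLp 2 p)) Z (abs_fatAngular_le_one hZ hS₁ hS₂) Φ (fun k₀ p => hΦ k₀ p)
    (π * (1 - 2 * M) / β) (2 * π / β) (2 * π / L) (fun m hm' => symbol_window hβ hM m hm') Gs hGsΦ q

include he hβ hm hd hd1 hd2 hZ hΦ hGsΦ hS₁ hS₂ in
omit [NeZero L] in
/-- **Time, first difference**: `‖Δ_{(1,0)} G̃(q)‖ ≤ 2g₁|2π/β|/Λ_{m₁}` for every `q`, provided `Λ_{m₁}β < π(2M − 3)`.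
[cite: BenfattoGiulianiMastropietro2006, §2.5 Lemma 2.2 (2.52)] -/
theorem norm_fwdDiff_time_fatPair_le (hM : klScale e₀ m₁ * β < π * (2 * M - 3)) (q : TorusSite 1 (2 * M) × TorusSite 2 L) :
    ‖fwdDiff ((fun _ : Fin 1 => (1 : ZMod (2 * M))), (0 : TorusSite 2 L)) Gs q‖ ≤
      2 * (d * e₀ ^ 2 * 1 + 1 * (d * e₀ ^ 2)) * |2 * π / β| * 1 / klScale e₀ m₁ := by
  obtain ⟨hGc, -, hG1, -, hGv⟩ := scaleProfile_mul_bounds he hm hd hd1 hd2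
  have hΛ : 0 < klScale e₀ m₁ := by rw [klScale]; positivity
  exact norm_fwdDiff_time_sampledSymbol_le hGc hΛ (by positivity) hG1 hGv
    (fun p : Fin 2 → ℝ => frameLevel μ K (WithLp.toLp 2 p)) Z (abs_fatAngular_le_one hZ hS₁ hS₂) Φ (fun k₀ p => hΦ k₀ p)
    (π * (1 - 2 * M) / β) (2 * π / β) (2 * π / L) (fun m hm' => symbol_window hβ hM m hm') Gs hGsΦ q

include hA he hz hz1 hgap h3 in
omit [NeZero L] [NeZero M] in
/-- Points of the enlarged square in the shell `|e_K| ≤ Λ_{m₁}` are in the OPEN square and in the Fermi region. [folklore] -/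
theorem fatPair_inner (p : Fin 2 → ℝ) (hsq : ∀ i, |p i| ≤ π + z) (hshell : |frameLevel μ K (WithLp.toLp 2 p)| ≤ klScale e₀ m₁) :
    (∀ i, |p i| < π) ∧ 1 ≤ ‖momToComplex p‖ := by
  have hΛe : klScale e₀ m₁ ≤ e₀ := klScale_le_e0 he.le m₁
  refine ⟨fun i => ?_, one_le_norm_of_frameBand_le hA h3 (hshell.trans hΛe)⟩
  by_contra hge
  push Not at hge
  have h1 : π - z ≤ |p i| := by linarith [hz.le]
  have := frameBand_zone hA hz1 hgap h1 (hsq i)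
  exact absurd (hshell.trans hΛe) (not_le.2 this)

include B hA hADt he hz hz1 hgap h3 hlo hhi hm hd hd1 hd2 hZ hΦ hGsΦ hS₁ hS₂ hδF hδ in
/-- **Space, second difference, along an integer step `u`** (`w = (2π/L)u`, `4π|u_j| ≤ zL`), tangency datum `|De_K(p_F(θ_c))w| ≤ τ₀`:
for every `q`, `‖Δ²_{(0,ū)} G̃(q)‖ ≤ ((4g₂+2g₁)τ²/Λ² + 2g₁K₂‖w‖²/Λ)·1 + 4g₁τ/Λ·z₁ + z₂`, `τ = τ₀ + K₂(ρ + 2‖w‖)‖w‖`, `K₂ = 4+4A`,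
`ρ = ρ₀ + δ_F`, `z₁ = |S₁||S₂|·4B_aD`, `z₂ = |S₁||S₂|(4B_aD² + 8B_a²D²)`, `D = (1+2/w_n)‖w₁+iw₂‖`.
[cite: BenfattoGiulianiMastropietro2006, §2.5 Lemma 2.2 (2.53)–(2.55), §2.7 (2.71a)] -/
theorem norm_fwdDiff_two_space_fatPair_le {Ba : ℝ} (hB0 : 0 ≤ Ba)
    (hB : ∀ (i : ℕ), i ≤ 2 → ∀ (n : ℕ) (ω : ℤ) (θ₀ : ℝ) (q w : Fin 2 → ℝ) (t : ℝ) {r₀ : ℝ}, 0 < r₀ →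
      r₀ ≤ ‖momToComplex (q + t • w)‖ → |sectorRelAngle θ₀ (q + t • w)| < π →
      ‖iteratedDeriv i (fun t : ℝ => sectorWeightCirc n ω (polarAngle (q + t • w))) t‖ ≤
        (2 : ℕ)! * Ba * ((1 + (sectorWidth n)⁻¹ * (2 : ℕ)!) * ‖momToComplex w‖ / r₀) ^ i)
    (u : Fin 2 → ℤ) (hu : ∀ j, 2 * |2 * π / L| * |(u j : ℝ)| ≤ z) {τ₀ : ℝ}
    (hτ₀ : |fderiv ℝ (fun p : Fin 2 → ℝ => frameLevel μ K (WithLp.toLp 2 p)) (klFermiPoint μ K θc) (fun j => 2 * π / L * (u j : ℝ))| ≤ τ₀)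
    (q : TorusSite 1 (2 * M) × TorusSite 2 L) :
    ‖((fwdDiff ((0 : TorusSite 1 (2 * M)), (fun j => ((u j : ℤ) : ZMod L))))^[2] Gs) q‖ ≤
      ((4 * (d * e₀ ^ 4 * 1 + 2 * (d * e₀ ^ 2) * (d * e₀ ^ 2) + 1 * (d * e₀ ^ 4)) + 2 * (d * e₀ ^ 2 * 1 + 1 * (d * e₀ ^ 2))) *
          (τ₀ + (4 + 4 * A) * (((klScale e₀ m₁ + B.smax * B.Dtmin * (3 * sectorWidth n / 4)) / (B.Dtmin - 2 * A) + δF) +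
            2 * ‖(fun j => 2 * π / L * (u j : ℝ))‖) * ‖(fun j => 2 * π / L * (u j : ℝ))‖) ^ 2 / klScale e₀ m₁ ^ 2 +
          2 * (d * e₀ ^ 2 * 1 + 1 * (d * e₀ ^ 2)) * ((4 + 4 * A) * ‖(fun j => 2 * π / L * (u j : ℝ))‖ ^ 2) / klScale e₀ m₁) * 1 +
        4 * (d * e₀ ^ 2 * 1 + 1 * (d * e₀ ^ 2)) *
          (τ₀ + (4 + 4 * A) * (((klScale e₀ m₁ + B.smax * B.Dtmin * (3 * sectorWidth n / 4)) / (B.Dtmin - 2 * A) + δF) +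
            2 * ‖(fun j => 2 * π / L * (u j : ℝ))‖) * ‖(fun j => 2 * π / L * (u j : ℝ))‖) / klScale e₀ m₁ *
          ((S₁.card * S₂.card : ℝ) * (4 * Ba * ((1 + 2 * (sectorWidth n)⁻¹) * ‖momToComplex (fun j => 2 * π / L * (u j : ℝ))‖))) +
        1 * 1 * ((S₁.card * S₂.card : ℝ) * (4 * Ba * ((1 + 2 * (sectorWidth n)⁻¹) * ‖momToComplex (fun j => 2 * π / L * (u j : ℝ))‖) ^ 2 +
          8 * Ba ^ 2 * ((1 + 2 * (sectorWidth n)⁻¹) * ‖momToComplex (fun j => 2 * π / L * (u j : ℝ))‖) ^ 2)) := by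
  obtain ⟨hGc, hG0, hG1, hG2, hGv⟩ := scaleProfile_mul_bounds he hm hd hd1 hd2
  have hΛ : 0 < klScale e₀ m₁ := by rw [klScale]; positivity
  have hL : (0 : ℝ) < L := Nat.cast_pos.2 (Nat.pos_of_ne_zero (NeZero.ne L))
  set w : Fin 2 → ℝ := fun j => 2 * π / L * (u j : ℝ) with hw
  set eK : (Fin 2 → ℝ) → ℝ := fun p => frameLevel μ K (WithLp.toLp 2 p) with heK
  have hDt : 0 < B.Dtmin - 2 * A := by linarith
  have hρ : 0 ≤ (klScale e₀ m₁ + B.smax * B.Dtmin * (3 * sectorWidth n / 4)) / (B.Dtmin - 2 * A) + δF := by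
    have := B.smax_pos; have := B.Dtmin_pos; have := sectorWidth_pos n; positivity
  have hD : 0 ≤ (1 + 2 * (sectorWidth n)⁻¹) * ‖momToComplex w‖ := by have := sectorWidth_pos n; positivity
  have hcard : (0 : ℝ) ≤ S₁.card * S₂.card := by positivity
  have hZ1 : ∀ (p₀ : Fin 2 → ℝ) (s : ℝ), (∀ i, |(p₀ + s • w) i| ≤ π + z) → |eK (p₀ + s • w)| ≤ klScale e₀ m₁ →
      |deriv (fun s : ℝ => Z (p₀ + s • w)) s| ≤ (S₁.card * S₂.card : ℝ) * (4 * Ba * ((1 + 2 * (sectorWidth n)⁻¹) * ‖momToComplex w‖)) := by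
    intro p₀ s hsq hshell
    obtain ⟨hin, hfermi⟩ := fatPair_inner hA he hz hz1 hgap h3 _ hsq hshell
    exact (abs_derivs_fatAngular_line_le hZ hz hB0 hB p₀ w hin hfermi).1
  have hZ2 : ∀ (p₀ : Fin 2 → ℝ) (s : ℝ), (∀ i, |(p₀ + s • w) i| ≤ π + z) → |eK (p₀ + s • w)| ≤ klScale e₀ m₁ →
      |iteratedDeriv 2 (fun s : ℝ => Z (p₀ + s • w)) s| ≤
        (S₁.card * S₂.card : ℝ) * (4 * Ba * ((1 + 2 * (sectorWidth n)⁻¹) * ‖momToComplex w‖) ^ 2 +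
          8 * Ba ^ 2 * ((1 + 2 * (sectorWidth n)⁻¹) * ‖momToComplex w‖) ^ 2) := by
    intro p₀ s hsq hshell
    obtain ⟨hin, hfermi⟩ := fatPair_inner hA he hz hz1 hgap h3 _ hsq hshell
    exact (abs_derivs_fatAngular_line_le hZ hz hB0 hB p₀ w hin hfermi).2
  have hxL : |2 * π / (L : ℝ)| * L = 2 * π := by
    rw [abs_of_pos (by positivity)]; field_simp
  have hZc : ContDiff ℝ 2 Z := by
    rw [show Z = _ from funext hZ]; exact contDiff_fatAngularFormula z n S₁ S₂
  exact norm_fwdDiff_two_space_sampledSymbol_le' hGc hΛ (by norm_num) (by positivity) (by positivity) hG0 hG1 hG2 hGv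
    (contDiff_frameBand μ K) (norm_iteratedFDeriv_two_frameBand_le hA μ) hZc zero_le_one
    (mul_nonneg hcard (mul_nonneg (mul_nonneg (by norm_num) hB0) hD))
    (mul_nonneg hcard (add_nonneg (mul_nonneg (mul_nonneg (by norm_num) hB0) (sq_nonneg _)) (by positivity)))
    (abs_fatAngular_le_one hZ hS₁ hS₂) w hZ1 hZ2 hρ hτ₀
    (fun p hsq hshell hZp => fatPair_cell B hA hADt he hz hz1 hgap hlo hhi hδ hZ p hsq hshell hZp)
    Φ (fun k₀ p => hΦ k₀ p) (π * (1 - 2 * M) / β) (2 * π / β) (2 * π / L) u rfl hu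
    (fun k₀ p hp => by
      rw [hΦ, mul_assoc, mul_left_comm, fatPair_profile_mul_angular_eq_zero hA he hz hz1 hgap hZ k₀ p hp, mul_zero]; simp)
    hxL Gs hGsΦ q

include B hA hADt he hz hz1 hgap h3 hlo hhi hm hd hd1 hd2 hZ hΦ hGsΦ hS₁ hS₂ hδF hδ in
/-- **Space, first difference, along an integer step `u`**: for every `q`, `‖Δ_{(0,ū)} G̃(q)‖ ≤ 2g₁τ/Λ·1 + 1·z₁` with the data of
`norm_fwdDiff_two_space_fatPair_le`. [cite: BenfattoGiulianiMastropietro2006, §2.5 Lemma 2.2 (2.53)–(2.55)] -/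
theorem norm_fwdDiff_space_fatPair_le {Ba : ℝ} (hB0 : 0 ≤ Ba)
    (hB : ∀ (i : ℕ), i ≤ 2 → ∀ (n : ℕ) (ω : ℤ) (θ₀ : ℝ) (q w : Fin 2 → ℝ) (t : ℝ) {r₀ : ℝ}, 0 < r₀ →
      r₀ ≤ ‖momToComplex (q + t • w)‖ → |sectorRelAngle θ₀ (q + t • w)| < π →
      ‖iteratedDeriv i (fun t : ℝ => sectorWeightCirc n ω (polarAngle (q + t • w))) t‖ ≤
        (2 : ℕ)! * Ba * ((1 + (sectorWidth n)⁻¹ * (2 : ℕ)!) * ‖momToComplex w‖ / r₀) ^ i)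
    (u : Fin 2 → ℤ) (hu : ∀ j, 2 * |2 * π / L| * |(u j : ℝ)| ≤ z) {τ₀ : ℝ}
    (hτ₀ : |fderiv ℝ (fun p : Fin 2 → ℝ => frameLevel μ K (WithLp.toLp 2 p)) (klFermiPoint μ K θc) (fun j => 2 * π / L * (u j : ℝ))| ≤ τ₀)
    (q : TorusSite 1 (2 * M) × TorusSite 2 L) :
    ‖fwdDiff ((0 : TorusSite 1 (2 * M)), (fun j => ((u j : ℤ) : ZMod L))) Gs q‖ ≤
      2 * (d * e₀ ^ 2 * 1 + 1 * (d * e₀ ^ 2)) *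
          (τ₀ + (4 + 4 * A) * (((klScale e₀ m₁ + B.smax * B.Dtmin * (3 * sectorWidth n / 4)) / (B.Dtmin - 2 * A) + δF) +
            2 * ‖(fun j => 2 * π / L * (u j : ℝ))‖) * ‖(fun j => 2 * π / L * (u j : ℝ))‖) / klScale e₀ m₁ * 1 +
        1 * 1 * ((S₁.card * S₂.card : ℝ) * (4 * Ba * ((1 + 2 * (sectorWidth n)⁻¹) * ‖momToComplex (fun j => 2 * π / L * (u j : ℝ))‖))) := by
  obtain ⟨hGc, hG0, hG1, -, hGv⟩ := scaleProfile_mul_bounds he hm hd hd1 hd2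
  have hΛ : 0 < klScale e₀ m₁ := by rw [klScale]; positivity
  have hL : (0 : ℝ) < L := Nat.cast_pos.2 (Nat.pos_of_ne_zero (NeZero.ne L))
  set w : Fin 2 → ℝ := fun j => 2 * π / L * (u j : ℝ) with hw
  set eK : (Fin 2 → ℝ) → ℝ := fun p => frameLevel μ K (WithLp.toLp 2 p) with heK
  have hDt : 0 < B.Dtmin - 2 * A := by linarith
  have hρ : 0 ≤ (klScale e₀ m₁ + B.smax * B.Dtmin * (3 * sectorWidth n / 4)) / (B.Dtmin - 2 * A) + δF := by
    have := B.smax_pos; have := B.Dtmin_pos; have := sectorWidth_pos n; positivity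
  have hcard : (0 : ℝ) ≤ S₁.card * S₂.card := by positivity
  have hD : 0 ≤ (1 + 2 * (sectorWidth n)⁻¹) * ‖momToComplex w‖ := by have := sectorWidth_pos n; positivity
  have hZ1 : ∀ (p₀ : Fin 2 → ℝ) (s : ℝ), (∀ i, |(p₀ + s • w) i| ≤ π + z) → |eK (p₀ + s • w)| ≤ klScale e₀ m₁ →
      |deriv (fun s : ℝ => Z (p₀ + s • w)) s| ≤ (S₁.card * S₂.card : ℝ) * (4 * Ba * ((1 + 2 * (sectorWidth n)⁻¹) * ‖momToComplex w‖)) := by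
    intro p₀ s hsq hshell
    obtain ⟨hin, hfermi⟩ := fatPair_inner hA he hz hz1 hgap h3 _ hsq hshell
    exact (abs_derivs_fatAngular_line_le hZ hz hB0 hB p₀ w hin hfermi).1
  have hxL : |2 * π / (L : ℝ)| * L = 2 * π := by
    rw [abs_of_pos (by positivity)]; field_simp
  have hZc : ContDiff ℝ 2 Z := by
    rw [show Z = _ from funext hZ]; exact contDiff_fatAngularFormula z n S₁ S₂
  have hG1' : ∀ u', |deriv (fun u => bgmCutoffSq e₀ ((16 : ℝ) ^ m₁ * u) * bgmCutoffSq e₀ ((16 : ℝ) ^ m₂ * u)) u'| ≤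
      (d * e₀ ^ 2 * 1 + 1 * (d * e₀ ^ 2)) / klScale e₀ m₁ ^ 2 := hG1
  exact norm_fwdDiff_space_sampledSymbol_le' hGc hΛ (by norm_num) (by positivity) hG0 hG1' hGv
    (contDiff_frameBand μ K) (norm_iteratedFDeriv_two_frameBand_le hA μ) hZc zero_le_one
    (mul_nonneg hcard (mul_nonneg (mul_nonneg (by norm_num) hB0) hD))
    (abs_fatAngular_le_one hZ hS₁ hS₂) w hZ1 hρ hτ₀
    (fun p hsq hshell hZp => fatPair_cell B hA hADt he hz hz1 hgap hlo hhi hδ hZ p hsq hshell hZp)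
    Φ (fun k₀ p => hΦ k₀ p) (π * (1 - 2 * M) / β) (2 * π / β) (2 * π / L) u rfl hu
    (fun k₀ p hp => by
      rw [hΦ, mul_assoc, mul_left_comm, fatPair_profile_mul_angular_eq_zero hA he hz hz1 hgap hZ k₀ p hp, mul_zero]; simp)
    hxL Gs hGsΦ q

include B hA hADt he hz hz1 hgap hlo hhi hβ hρA hm hd hd1 hd2 hZ hΦ hGsΦ hδF hδ in
/-- **Support count**: time window × rotated box around `p_F(θ_c)` of radius `ρ = ρ₀ + δ_F`:
`#{G̃ ≠ 0} ≤ (Λ_{m₁}β/π + 1)·(√2 L (Λ_{m₁} + (4+4A)ρ²)/(γπ) + 2)(√2 L (2ρ)/π + 2)`, `γ = 2ρ_min − 4A`.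
[cite: BenfattoGiulianiMastropietro2006, §2.5 (2.46)–(2.50)] -/
theorem card_support_fatPair_le [DecidablePred fun q : TorusSite 1 (2 * M) × TorusSite 2 L => Gs q ≠ 0] :
    (((univ : Finset (TorusSite 1 (2 * M) × TorusSite 2 L)).filter fun q => Gs q ≠ 0).card : ℝ) ≤
      (klScale e₀ m₁ * β / π + 1) *
        ((Real.sqrt 2 * L * ((klScale e₀ m₁ + (4 + 4 * A) *
            ((klScale e₀ m₁ + B.smax * B.Dtmin * (3 * sectorWidth n / 4)) / (B.Dtmin - 2 * A) + δF) ^ 2) / (2 * B.rhomin - 4 * A)) / π + 2) *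
          (Real.sqrt 2 * L * (2 * ((klScale e₀ m₁ + B.smax * B.Dtmin * (3 * sectorWidth n / 4)) / (B.Dtmin - 2 * A) + δF)) / π + 2)) := by
  classical
  obtain ⟨-, -, -, -, hGv⟩ := scaleProfile_mul_bounds he hm hd hd1 hd2
  have hΛ : 0 < klScale e₀ m₁ := by rw [klScale]; positivity
  have hL : (0 : ℝ) < L := Nat.cast_pos.2 (Nat.pos_of_ne_zero (NeZero.ne L))
  have hπ := Real.pi_pos
  have hxL : |2 * π / (L : ℝ)| * L = 2 * π := by rw [abs_of_pos (by positivity)]; field_simp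
  set ρ : ℝ := (klScale e₀ m₁ + B.smax * B.Dtmin * (3 * sectorWidth n / 4)) / (B.Dtmin - 2 * A) + δF with hρdef
  have hρ0 : 0 ≤ ρ := by
    have := B.smax_pos; have := B.Dtmin_pos; have := sectorWidth_pos n
    have : 0 < B.Dtmin - 2 * A := by linarith
    positivity
  set pF : Fin 2 → ℝ := klFermiPoint μ K θc with hpF
  set eK : (Fin 2 → ℝ) → ℝ := fun p => frameLevel μ K (WithLp.toLp 2 p) with heK
  have hcount := card_support_sampledSymbol_le (P := 2 * M) (L := L) hΛ hGv eK Z (pF := pF) (ρ := ρ) hz.le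
    (fun p hsq hshell hZp => fatPair_cell B hA hADt he hz hz1 hgap hlo hhi hδ hZ p hsq hshell hZp)
    Φ (fun k₀ p => hΦ k₀ p) (π * (1 - 2 * M) / β) (2 * π / β) (2 * π / L) hxL Gs hGsΦ
  have hT : (((univ : Finset (TorusSite 1 (2 * M))).filter fun i =>
      |π * (1 - 2 * M) / β + 2 * π / β * (((i 0).val : ℕ) : ℝ)| ≤ klScale e₀ m₁).card : ℝ) ≤ klScale e₀ m₁ * β / π + 1 := by
    have h := card_filter_timeWindow_le (P := 2 * M) (a₀ := π * (1 - 2 * M) / β) (h₀ := 2 * π / β) (Λ := klScale e₀ m₁)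
      (by positivity) hΛ.le
    refine h.trans (le_of_eq ?_)
    field_simp
  have hlo' : a ≤ μ - A := by linarith
  have hhi' : μ + A ≤ b := by linarith
  have hγ : 0 < 2 * B.rhomin - 4 * A := by linarith
  have hX : (((univ : Finset (TorusSite 2 L)).filter fun k =>
      |eK (fun j => 2 * π / L * (((k j).valMinAbs : ℤ) : ℝ))| ≤ klScale e₀ m₁ ∧
        ‖(fun j => 2 * π / L * (((k j).valMinAbs : ℤ) : ℝ)) - pF‖ ≤ ρ).card : ℝ) ≤
      (Real.sqrt 2 * L * ((klScale e₀ m₁ + (4 + 4 * A) * ρ ^ 2) / (2 * B.rhomin - 4 * A)) / π + 2) *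
        (Real.sqrt 2 * L * (2 * ρ) / π + 2) := by
    refine card_filter_cell_le L (contDiff_frameBand μ K) (norm_iteratedFDeriv_two_frameBand_le hA μ)
      (pF := pF) (frameLevel_klFermiPoint B hA hlo' hhi' θc) hΛ.le hρ0 hγ
      (gradient_floor_klFermiPoint B hA hlo' hhi' θc) _ ?_
    intro k hk
    obtain ⟨h1, h2⟩ := (Finset.mem_filter.1 hk).2
    have e : (fun j => 2 * π * (((k j).valMinAbs : ℤ) : ℝ) / L) = fun j => 2 * π / L * (((k j).valMinAbs : ℤ) : ℝ) :=
      funext fun j => by ring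
    rw [e]; exact ⟨h1, h2⟩
  calc _ ≤ ((((univ : Finset (TorusSite 1 (2 * M))).filter fun i =>
        |π * (1 - 2 * M) / β + 2 * π / β * (((i 0).val : ℕ) : ℝ)| ≤ klScale e₀ m₁).card *
        ((univ : Finset (TorusSite 2 L)).filter fun k =>
          |eK (fun j => 2 * π / L * (((k j).valMinAbs : ℤ) : ℝ))| ≤ klScale e₀ m₁ ∧
            ‖(fun j => 2 * π / L * (((k j).valMinAbs : ℤ) : ℝ)) - pF‖ ≤ ρ).card : ℕ) : ℝ) := by exact_mod_cast hcount
    _ ≤ _ := by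
        push_cast
        exact mul_le_mul hT hX (Nat.cast_nonneg _) (by positivity)

end FatPair

end Summit.HubbardSuperconductivity.HubbardSuperconductivity.Theorems.TorusFourierL2

end
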